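import Literature.NumberTheory.LFunctions.Zhang2022.RepairDoneCondition
import Literature.NumberTheory.LFunctions.Zhang2022.DetectorDictShiftDischarge
import Literature.NumberTheory.LFunctions.Zhang2022.RepairDetEntangledUnconditional

/-!
# Zhang (2022) §18-margin repair rung, barrier extension (cell landau-siegel §E): the §6 D1 DONE-CONDITION object,
# continuation file (version 17 read-backs; versions 18, …) — `RepairDoneCondition.lean` (versions 10–17) is at the line cap

Y. Zhang, *Discrete mean estimates and the Landau–Siegel zero*, arXiv:2211.02515v1 (2022) [Zhang2022LandauSiegel] —
an unrefereed manuscript under adjudication. **WHAT THIS IS NOT: a claim about its Theorems 1–2, about Landau–Siegel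
zeros, about Parity, or about a repaired `Margin232`. The programme SEARCHES and TYPES; no claim about Landau–Siegel
zeros, Theorems 1–2 of arXiv:2211.02515 or a repaired Margin232 until a kernel theorem says so.**

ONE-WRITER file (pen ls-barrier-p5; append-only). Each version of the D1 object is the conjunction of LANDED kernel facts
cited by name, nothing re-proved: (1) the class of record `Repair.RplusplusN` is DECIDED; (2) the latest intake lists of the
four design-class KILL words (`bmultiWord6`, `blenWord4`, `bdetWord2`, `bellWord`) are sub-lists of it; (3) the endgame word
B-fam `bfamWord` is DECIDED in its own class; (4) the B-dh consistency-model word holds on the whole kernel-typed menu; and,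
from version 17 on, (5) the B-det word's displayed premise E-102 `Det.EdetPremise (Ioo 0 1) (Ioo 0 5)` BY THEOREM
(`Det.edetPremise_unit`, ls-barrier-p2 g4 p496401). Read-backs record which further DISPLAYED premises are theorems.
Outward sentence of record (director-frontier g6 01:16:31Z, updated at v17): the §E done-condition is MET IN FORM modulo
the ledger — displayed premises remaining: E-014 ∧ E-022 (B-ell model rows); E-102 DISCHARGED. Nothing of the NOT-COVERED
LEDGER (barrier/BARRIER-STATE.md §2′) is asserted; nothing about zeros of `L`-functions.

## Part 0 — version 17 read-backs (the object of record is `Repair.doneCondition_v17`, `RepairDoneCondition`, 5 conjuncts,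
p497077; these two read-backs were in the superseded filing p497075 and are re-landed here verbatim in content)

* `doneCondition_v17_class` — the OBJECT = CLASS spelling (conjuncts (1)–(4), the shape of `_v10`…`_v16`);
* `doneCondition_v17_detSlots` — the three detector premises BY THEOREM: E-102 in full, and for every sign-admissible `b`
  the glued slots `Det.DictShiftPSD b` (row 56, `Det.dictShiftPSD_of_signAdmissible`, ls-barrier-p6 g3 p495442) and
  `Det.GluedFormPSD b` (row 57, `Det.gluedFormPSD_of_signAdmissible`, ls-barrier-p5 g4 p495072).

References: Y. Zhang, arXiv:2211.02515v1 (2022), §2 (2.13), Lemma 2.3, (2.32)–(2.33); §7 Prop. 7.1 (7.2); §12 (12.6)–(12.8);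
§18 (18.1), (18.9)–(18.12). [cite: Zhang2022LandauSiegel, §§2, 7, 12, 18]
-/

noncomputable section

namespace Literature.NumberTheory.LFunctions.Zhang2022

namespace Repair

open Det

/-! ### Part 0 — version 17 read-backs -/

/-- **Version 17, OBJECT = CLASS spelling** (conjuncts (1)–(4) of `doneCondition_v17`, the shape of versions 10–16):
`Rplusplus17` DECIDED; the four design-class words' latest intake lists inside it; `bfamWord` DECIDED; the B-dh menu
consistent BY THEOREM. [cite: Zhang2022LandauSiegel, §2 (2.32)–(2.33); §7 Prop 7.1 (7.2); §18 (18.9)–(18.12)] -/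
theorem doneCondition_v17_class :
    ClassDecided Rplusplus17 ∧
      ((∀ F ∈ bmultiWord6, F ∈ Rplusplus17) ∧ (∀ F ∈ blenWord4, F ∈ Rplusplus17) ∧
        (∀ F ∈ bdetWord2, F ∈ Rplusplus17) ∧ (∀ F ∈ bellWord, F ∈ Rplusplus17)) ∧
      ClassDecided bfamWord ∧
      (DH.MenuConsistent ∧ DH.MenuConsistentPrimes ∧ DH.MenuInformalConsistent) :=
  ⟨doneCondition_v17.1, doneCondition_v17.2.1, doneCondition_v17.2.2.1, doneCondition_v17.2.2.2.1⟩

/-- **Version 17 read-back — the detector premises are THEOREMS**: E-102 in full `Det.EdetPremise (0,1) (0,5)`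
(`Det.edetPremise_unit` p496401: head 1 `Det.edetCone_unit` ∧ head 2 `Det.monomialConePSD_unit` p490608), and for every
sign-admissible `b` the glued slots of rows 56/57 (`Det.dictShiftPSD_of_signAdmissible` p495442,
`Det.gluedFormPSD_of_signAdmissible` p495072). [cite: Zhang2022LandauSiegel, §7 Prop 7.1 p.44 (7.2); §12 (12.6)–(12.8); §18 (18.1)] -/
theorem doneCondition_v17_detSlots :
    Det.EdetPremise (Set.Ioo 0 1) (Set.Ioo 0 5) ∧
      ∀ b : Fin 3 → ℝ, Det.SignAdmissible b → Det.DictShiftPSD b ∧ Det.GluedFormPSD b :=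
  ⟨doneCondition_v17.2.2.2.2, fun _ hb => ⟨Det.dictShiftPSD_of_signAdmissible hb, Det.gluedFormPSD_of_signAdmissible hb⟩⟩

/-! ### Version 18 — class of record `Rplusplus18` (`RepairRplusPlus7` v18, 58 families: v17 + row 58 `familyDetEntangledUncond`,
the slot-free twin of row 40 `familyDetEntangled` — ENTANGLED `K`-block detectors read OUTRIGHT; E-102 head 1 `Det.edetCone_unit`
(SOS route, ls-barrier-p2 g4 p496401), head 2 `Det.monomialConePSD_unit` p490608; row object `RepairDetEntangledUnconditional`,
ls-Bdet-typer-2 g3 p496742). Same words, same B-fam / B-dh conjuncts, conjunct (5) E-102 as v17. KILL(B-det)'s qualifier (b) is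
discharged in the kernel: the two conditional rows of `bdetWord2` read OUTRIGHT by `Repair.bdet2_verdicts` (p496742; cited, not
restated); the word-level read-back `doneCondition_v16_words_decided` / `doneCondition_v17_words_decided` applies verbatim (same
word lists), and `doneCondition_v17_detSlots` (Part 0) is the slot read-back — neither is restated (dedup rule). -/

/-- **THE DONE-CONDITION OF SUB-CELL E, version 18 (§6 D1 object on the class of record `Rplusplus18`, 58 families).**
Conjunction of landed kernel facts by name: `Rplusplus18` DECIDED (`rplusplus18_decided`); the four design-class words' latest
intake lists inside it (`rplusplus18_words_sub`); `bfamWord` DECIDED; the B-dh menu consistent BY THEOREM; E-102 in full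
`Det.EdetPremise (Ioo 0 1) (Ioo 0 5)` BY THEOREM. Nothing is asserted about the not-covered ledger or about zeros of `L`-functions.
[cite: Zhang2022LandauSiegel, §2 (2.32)–(2.33); §7 Prop 7.1 (7.2); §18 (18.9)–(18.12)] -/
theorem doneCondition_v18 :
    ClassDecided Rplusplus18 ∧
      ((∀ F ∈ bmultiWord6, F ∈ Rplusplus18) ∧ (∀ F ∈ blenWord4, F ∈ Rplusplus18) ∧
        (∀ F ∈ bdetWord2, F ∈ Rplusplus18) ∧ (∀ F ∈ bellWord, F ∈ Rplusplus18)) ∧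
      ClassDecided bfamWord ∧
      (DH.MenuConsistent ∧ DH.MenuConsistentPrimes ∧ DH.MenuInformalConsistent) ∧
      Det.EdetPremise (Set.Ioo 0 1) (Set.Ioo 0 5) :=
  ⟨rplusplus18_decided, rplusplus18_words_sub, bfamWord_decided,
    ⟨DH.menuConsistent_holds, DH.menuConsistentPrimes_holds, DH.menuInformalConsistent_holds⟩, Det.edetPremise_unit⟩

/-- **Read-back at version 18 — the FOUR slot-free detector rows are in the class of record and decided**: rows 55
(`familyDetShiftUncond`), 56 (`familyDetGluedUncond`), 57 (`familyDetGluedSepUncond`), 58 (`familyDetEntangledUncond`) are members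
of `Rplusplus18`, hence decided by `doneCondition_v18` — every detector family of the B-det intake now has an UNCONDITIONAL row.
[cite: Zhang2022LandauSiegel, §2 Lemma 2.3, (2.32)–(2.33); §7 Prop 7.1 (7.2)] -/
theorem doneCondition_v18_detRows :
    (familyDetShiftUncond ∈ Rplusplus18 ∧ familyDetGluedUncond ∈ Rplusplus18 ∧
        familyDetGluedSepUncond ∈ Rplusplus18 ∧ familyDetEntangledUncond ∈ Rplusplus18) ∧
      (familyDetShiftUncond.Decided ∧ familyDetGluedUncond.Decided ∧
        familyDetGluedSepUncond.Decided ∧ familyDetEntangledUncond.Decided) := by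
  have h55 : familyDetShiftUncond ∈ Rplusplus18 :=
    rplusplus17_sub_rplusplus18 _ ((mem_rplusplus17_iff _).2 (by simp only [true_or, or_true]))
  have h56 : familyDetGluedUncond ∈ Rplusplus18 :=
    rplusplus17_sub_rplusplus18 _ ((mem_rplusplus17_iff _).2 (by simp only [true_or, or_true]))
  have h57 : familyDetGluedSepUncond ∈ Rplusplus18 :=
    rplusplus17_sub_rplusplus18 _ ((mem_rplusplus17_iff _).2 (by simp only [or_true]))
  have h58 : familyDetEntangledUncond ∈ Rplusplus18 := rplusplus18_detEntangled_rows.2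
  exact ⟨⟨h55, h56, h57, h58⟩, doneCondition_v18.1 _ h55, doneCondition_v18.1 _ h56, doneCondition_v18.1 _ h57,
    doneCondition_v18.1 _ h58⟩

/-! ### Version 19 — class of record `Rplusplus19` (`RepairRplusPlus7` v19, 60 families: v18 + rows 59 `familyDetPositive` /
60 `familyDetShiftDiscrete`, the two DISCRETE-currency detector rows of `RepairDetDiscrete`, ls-barrier-p6 g3 p496281, REF-E E-45;
kind THRESHOLD — coverage of the B-det intake unchanged). Same words, same B-fam / B-dh conjuncts, conjunct (5) E-102 as v17/v18;
the word-level and slot read-backs of versions 16/17/18 apply verbatim and are not restated (dedup rule). New read-back: row 60's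
only displayed input `Skeleton.Prop22 c′` is a tree theorem for `c′ ≥ c₀` — cited from `Repair.rplusplus19_row60_closed`. -/

/-- **THE DONE-CONDITION OF SUB-CELL E, version 19 (§6 D1 object on the class of record `Rplusplus19`, 60 families).**
Conjunction of landed kernel facts by name: `Rplusplus19` DECIDED (`rplusplus19_decided`); the four design-class words' latest
intake lists inside it (`rplusplus19_words_sub`); `bfamWord` DECIDED; the B-dh menu consistent BY THEOREM; E-102 in full
`Det.EdetPremise (Ioo 0 1) (Ioo 0 5)` BY THEOREM. Nothing is asserted about the not-covered ledger or about zeros of `L`-functions.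
[cite: Zhang2022LandauSiegel, §2 (2.32)–(2.33); §7 Prop 7.1 (7.2); §18 (18.9)–(18.12)] -/
theorem doneCondition_v19 :
    ClassDecided Rplusplus19 ∧
      ((∀ F ∈ bmultiWord6, F ∈ Rplusplus19) ∧ (∀ F ∈ blenWord4, F ∈ Rplusplus19) ∧
        (∀ F ∈ bdetWord2, F ∈ Rplusplus19) ∧ (∀ F ∈ bellWord, F ∈ Rplusplus19)) ∧
      ClassDecided bfamWord ∧
      (DH.MenuConsistent ∧ DH.MenuConsistentPrimes ∧ DH.MenuInformalConsistent) ∧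
      Det.EdetPremise (Set.Ioo 0 1) (Set.Ioo 0 5) :=
  ⟨rplusplus19_decided, rplusplus19_words_sub, bfamWord_decided,
    ⟨DH.menuConsistent_holds, DH.menuConsistentPrimes_holds, DH.menuInformalConsistent_holds⟩, Det.edetPremise_unit⟩

/-- **Read-back at version 19 — the two DISCRETE-currency detector rows are in the class of record and decided, and row 60
reads WITHOUT displayed input for `c′ ≥ c₀`** (`Repair.rplusplus19_row60_closed`, from `Skeleton.prop22_eventually`; row 59's
per-member positivity stays displayed — kind THRESHOLD). [cite: Zhang2022LandauSiegel, §2 Prop. 2.2, Lemma 2.3, (2.16)–(2.19), (2.32)–(2.34)] -/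
theorem doneCondition_v19_detDiscreteRows :
    (familyDetPositive ∈ Rplusplus19 ∧ familyDetShiftDiscrete ∈ Rplusplus19) ∧
      (familyDetPositive.Decided ∧ familyDetShiftDiscrete.Decided) ∧
      ∃ c₀ : ℝ, 0 ≤ c₀ ∧ ∀ p : DetShiftDiscreteDesign, p.InClass → c₀ ≤ p.c' → ∀ hbox : Det.InShiftBox p.b,
        Skeleton.ForAllLarge fun D _ χ => ∀ u : Fin p.r → (_ : Skeleton.Chr D) × ℂ → ℂ,
          ¬ (p.Φ (((Det.shiftDesign ⟨p.b, ![-1, 1, -1]⟩ hbox).detector p.c').gram χ u) < 0) :=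
  ⟨rplusplus19_detDiscrete_rows.1,
    ⟨doneCondition_v19.1 _ rplusplus19_detDiscrete_rows.1.1, doneCondition_v19.1 _ rplusplus19_detDiscrete_rows.1.2⟩,
    rplusplus19_row60_closed⟩

end Repair

end Literature.NumberTheory.LFunctions.Zhang2022

end
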